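import Summits.CriticalPhenomena.PercolationContinuityZ3.Theorems.PercNearOneGluingNoHeavyLowerTailSahiMixtureLaw

/-!
# All-orders Sahi positivity of a finite family of events under ANY probability weight is decided by its SQUARE-FREE rows;
# over three events it is `{Cov ≥ 0, Cov ≥ 0, Cov ≥ 0, E_3 ≥ 0}`

Support file of the one-cut programme (crux `NoHeavyLowerTail`, stmt-CriticalPhenomena-4575; cell `prim-masterthm`, seat P3, gen 5;
`run/shared/lean/prim/prim-masterthm/prim-masterthm-p3/HIERARCHY.md` §12(b)).  The law-level companion of the comb-level RANGE LIFTING of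
`…SahiCombRange` (gen 4, product measures, tensor-Bernstein coefficients) and the `h`-free shadow of `…SahiMixtureLaw.bernsteinPos_sahiE_of_injective`.

* **`allOrders_iff_squarefree`**: for a probability weight `μ` on a finite type and events `A_0,…,A_{n−1}`, `E_m(μ; 1_{A∘s}) ≥ 0` for EVERY multiset
  `s : Fin m → Fin n` ⟺ for every INJECTIVE `s` (so `m ≤ n`): the `2^n − n − 1` square-free rows `E_J ≥ 0`, `J ⊆ [n]`, `|J| ≥ 2`, decide Sahi positivity at every
  order (a repeated member contains the intersection of the others; seat P5's "Theorem E" `SahiDefectExpansion.sahiE_cons_nonneg_of_absorbs_top` + strong induction).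
  So the class `K_n` of all-orders-positive pattern laws on `2^[n]` (HIERARCHY §11–§12; the domain of the MIXTURE CONJECTURE) is the basic semialgebraic set cut out by
  the square-free rows — ttrl cp-mix's grid observation "K(≤6) = the 4-constraint set" at `n = 3` (MIXCOMB.md §4) as a theorem for every `n` and every measure.
* **`allOrders_three_iff`**: over THREE events, all orders ⟺ `Cov(A_0,A_1), Cov(A_0,A_2), Cov(A_1,A_2) ≥ 0` and `E_3(A_0,A_1,A_2) ≥ 0` — the measure-free form of
  "over three events the hierarchy collapses to the cubic row" (`…SahiCombRange.combPos_sahiE_ind_iff_of_three` at the comb level, where the covariances are automatic);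
  compare seat P2's `M4.sahiPositive_iff_two_and_row` (lattice `M_4`).  `allOrders_three_of_rows` feeds `…SahiMixtureLawThree.mixture_three` from the four rows.
HONEST FRAMING: a reduction, not a positivity theorem; Sahi's conjectures stay open. [this work]
-/

noncomputable section

open scoped Classical

namespace Summit.CriticalPhenomena.PercolationContinuityZ3.Theorems

open Finset Function
open Literature.Combinatorics.Sahi2008
open Literature.Probability.Percolation.BHK2006 (ind_le_one)
open Literature.Probability.Percolation.DecisionTree (ind ind_of_mem ind_of_not_mem ind_nonneg)

namespace SahiMixture

variable {α : Type*} [Fintype α]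

/-- **ALL ORDERS ⟺ SQUARE-FREE ROWS** (any probability weight, any finite family of events).  `E_m(μ; 1_{A_{s 0}},…,1_{A_{s (m−1)}}) ≥ 0` for every
slot map `s` iff it holds for every injective `s`. [this work] -/
theorem allOrders_iff_squarefree {μ : α → ℝ} (hμ : ∀ a, 0 ≤ μ a) (hμ1 : ∑ a, μ a = 1) {n : ℕ} (A : Fin n → Set α) :
    AllOrders μ A ↔ ∀ (m : ℕ) (s : Fin m → Fin n), Injective s → 0 ≤ sahiE μ m (fun j => ind (A (s j))) := by
  refine ⟨fun h m s _ => h m s, fun hinj => ?_⟩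
  intro m
  induction m using Nat.strong_induction_on with
  | _ m ih =>
    intro s
    by_cases hs : Injective s
    · exact hinj m s hs
    obtain ⟨k, rfl⟩ : ∃ k, m = k + 2 := ⟨m - 2, by
      have : ¬ m ≤ 1 := fun h => hs (injective_of_le_one h s)
      omega⟩
    obtain ⟨σ, c, hc⟩ := exists_swap_head_repeat hs
    set d : α → ℝ := ind (A (s (σ 0))) with hd
    set g : Fin (k + 1) → α → ℝ := fun i => ind (A (s (σ i.succ))) with hg
    have hperm : sahiE μ (k + 2) (fun j => ind (A (s j))) = sahiE μ (k + 2) (Fin.cons d g : Fin (k + 2) → α → ℝ) := by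
      rw [← sahiE_comp_perm μ (k + 2) σ (fun j => ind (A (s j)))]
      congr 1
      funext j
      refine Fin.cases ?_ (fun i => ?_) j
      · simp [hd]
      · simp [hg]
    rw [hperm]
    refine SahiDefectExpansion.sahiE_cons_nonneg_of_absorbs_top hμ hμ1 k d g (fun i a => ind_nonneg _ _) (fun a => ind_le_one _ _)
      (fun a => ?_) (fun T _ => ?_)
    · -- the head is repeated in the tail, so it absorbs the total product
      rw [← Finset.mul_prod_erase _ _ (Finset.mem_univ c)]
      have hgc : g c a = d a := by simp [hg, hd, hc]
      rw [hgc]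
      by_cases ha : a ∈ A (s (σ 0))
      · simp [hd, ind_of_mem ha]
      · simp [hd, ind_of_not_mem ha]
    · have hlt : Tᶜ.card < k + 2 := lt_of_le_of_lt (Finset.card_le_univ _) (by simp)
      exact ih _ hlt (fun j => s (σ (Tᶜ.orderEmbOfFin rfl j).succ))

/-- Slot maps into `Fin 3`: an injective one has `m ≤ 3`. [folklore] -/
theorem le_three_of_injective {m : ℕ} (s : Fin m → Fin 3) (hs : Injective s) : m ≤ 3 := by
  simpa using Fintype.card_le_of_injective s hs

/-- **THREE EVENTS: all orders ⟺ the three covariances and the cubic row.**  For a probability weight `μ` on a finite type and events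
`A_0, A_1, A_2`: `E_m(μ; 1_{A∘s}) ≥ 0` for every multiset `s` iff `Cov(A_i,A_j) ≥ 0` (`i < j`) and `E_3(1_{A_0},1_{A_1},1_{A_2}) ≥ 0`. [this work] -/
theorem allOrders_three_iff {μ : α → ℝ} (hμ : ∀ a, 0 ≤ μ a) (hμ1 : ∑ a, μ a = 1) (A : Fin 3 → Set α) :
    AllOrders μ A ↔
      (∀ i j : Fin 3, i < j → ex μ (ind (A i)) * ex μ (ind (A j)) ≤ ex μ (ind (A i) * ind (A j))) ∧
        0 ≤ sahiE μ 3 ![ind (A 0), ind (A 1), ind (A 2)] := by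
  constructor
  · intro h
    refine ⟨fun i j _ => ?_, ?_⟩
    · have h2 := h 2 ![i, j]
      rw [sahiE_two_apply] at h2
      simp only [Matrix.cons_val_zero, Matrix.cons_val_one] at h2
      linarith
    · have h3 := h 3 id
      have e : (fun j => ind (A (id j))) = ![ind (A 0), ind (A 1), ind (A 2)] := funext fun j => by fin_cases j <;> rfl
      rwa [e] at h3
  · rintro ⟨hcov, hE3⟩
    -- covariances in both slot orders
    have hcov' : ∀ i j : Fin 3, i ≠ j → ex μ (ind (A i)) * ex μ (ind (A j)) ≤ ex μ (ind (A i) * ind (A j)) := by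
      intro i j hij
      rcases lt_or_gt_of_ne hij with h | h
      · exact hcov i j h
      · rw [mul_comm, mul_comm (ind (A i))]; exact hcov j i h
    refine (allOrders_iff_squarefree hμ hμ1 A).2 fun m s hs => ?_
    have hm := le_three_of_injective s hs
    interval_cases m
    · rw [sahiE_zero]
    · rw [sahiE_one_apply]; exact ex_nonneg hμ (ind_nonneg _)
    · rw [sahiE_two_apply]
      have h := hcov' (s 0) (s 1) (fun e => by have := hs e; exact absurd this (by decide))
      linarith
    · -- a bijection of `Fin 3`: `E_3` is symmetric
      have hbij : Bijective s := (Fintype.bijective_iff_injective_and_card s).2 ⟨hs, by simp⟩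
      have e : (fun j => ind (A (s j))) = fun j => (![ind (A 0), ind (A 1), ind (A 2)]) (Equiv.ofBijective s hbij j) := by
        funext j
        have : (![ind (A 0), ind (A 1), ind (A 2)]) (s j) = ind (A (s j)) := by
          rcases (show s j = 0 ∨ s j = 1 ∨ s j = 2 by omega) with h | h | h <;> rw [h] <;> rfl
        simpa using this.symm
      rw [e, sahiE_comp_perm μ 3 (Equiv.ofBijective s hbij)]
      exact hE3

/-- **All orders from the four rows** (feeds `…SahiMixtureLawThree.mixture_three`): `Cov ≥ 0` (three pairs) and `E_3 ≥ 0` give Sahi positivity of the triple at every order, hence (there) Bernstein positivity of every OR-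
and AND-mixture of an independent coin at every order. [this work] -/
theorem allOrders_three_of_rows {μ : α → ℝ} (hμ : ∀ a, 0 ≤ μ a) (hμ1 : ∑ a, μ a = 1) (A : Fin 3 → Set α)
    (hcov : ∀ i j : Fin 3, i < j → ex μ (ind (A i)) * ex μ (ind (A j)) ≤ ex μ (ind (A i) * ind (A j)))
    (hE3 : 0 ≤ sahiE μ 3 ![ind (A 0), ind (A 1), ind (A 2)]) : AllOrders μ A :=
  (allOrders_three_iff hμ hμ1 A).2 ⟨hcov, hE3⟩

end SahiMixture

end Summit.CriticalPhenomena.PercolationContinuityZ3.Theorems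

end
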